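import Summits.HubbardSuperconductivity.HubbardSuperconductivity.Theorems.AnisotropyChordTransferFibre3RowCBand
import Summits.HubbardSuperconductivity.HubbardSuperconductivity.Theorems.AnisotropyChordTransferFibre3RowCL2N11593

/-!
# Route `AnisotropyChord` / H0 rotor rung, LEVEL 2 row C (KT-2b), BANDED η-FACTORISED SHARP program: the cell `ν ∈ [11593, 12057]/10⁶`, `a ∈ [1/2, 3/5]`

One `(ν, a)`-cell of the `∀L ≥ 128` kernel certificate of the off-pole tail bound (KT-2b″) with the PartN41-E §1 window-shell
cancellation, the η²-factorised evaluation AND the manifold t-band in the `t·R̄` slots (`…RowCBand`: `rowCEFT`):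
★ `cellT11593C05000W06000_rowC` : `RowC.rowCCellCheckFT colN11593 1/2 3/5 449/100 33/25 (50, 24) = true` (one kernel `decide`), composed with
`RowC.offPoleTail_of_rowCCheckFT`, the column's X-sum bracket `xsN11593` and p2's `colN11593_check`:
★★ `offPoleTailT_cellN11593C05000W06000`: for EVERY `L ≥ 128` and every ground two-magnon profile (`0 ≤ Δ < 1`) with `ν`, `a` in the cell,
`‖R′‖² − P − lowN ≤ (33/25)·η_eff·(2ε₁ − T⁺)·U`.  (Supersedes the crude/sharp constants of `…RowCL2N/L2S11593…` on this cell.)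
Prover seat `hubbard-h0-rotor-p1` g28–g29 (route lead); helper for piece A = stmt-HubbardSuperconductivity-23918 of rung 19089
(`--supports`, helper class).  Nothing here proves superconductivity in the Hubbard model; one kernel-certified piece of ONE
conditional reduction (the GM₃ ∀L certificate, Level-2 row C = KT-2b); the rotor TARGET as originally worded stays FALSE (g15 verdict).
Mathlib + the tree only; no sorry.  Generated by p1 g28–g29 rowc/mkfiles.py (HOME/hubbard-h0-rotor-p1/rowc/).
-/

set_option linter.dupNamespace false
set_option autoImplicit false

open Literature.Analysis.ValidatedNumerics

namespace Summit.HubbardSuperconductivity.HubbardSuperconductivity.Theorems.AnisotropyChord.Transfer.Fibre3.L2.KT2b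

open L2.N1

/-- ★ the banded η-factorised sharp row-C `RExpr` cell check passes with `b = 33/25` on `a ∈ [1/2, 3/5]` over the column `colN11593`. -/
theorem cellT11593C05000W06000_rowC :
    RowC.rowCCellCheckFT colN11593 ((1 : ℚ) / 2) ((3 : ℚ) / 5) ((449 : ℚ) / 100) ((33 : ℚ) / 25) (50, 24) = true := by
  decide +kernel

/-- ★★ on this cell, for EVERY `L ≥ 128` and every ground profile: `‖R′‖² − P − lowN ≤ (33/25)·η_eff·(2ε₁ − T⁺)·U`. -/
theorem offPoleTailT_cellN11593C05000W06000 (L : ℕ) [NeZero L] (hL : 128 ≤ L) {Δ lam2 : ℝ} {f : Tor L → ℝ} (hΔ0 : 0 ≤ Δ) (hΔ1 : Δ < 1)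
    (hf : IsGroundTwoMagnon L Δ lam2 f)
    (hν1 : (11593 : ℝ) / 1000000 ≤ lam2 / (2 * Real.pi / L) ^ 2) (hν2 : lam2 / (2 * Real.pi / L) ^ 2 ≤ (12057 : ℝ) / 1000000)
    (ha1 : ((1 : ℝ) / 2) ≤ Δ * f (K1 L)) (ha2 : Δ * f (K1 L) ≤ ((3 : ℝ) / 5)) :
    (ip L (resid L Δ f) (resid L Δ f)).re - polePart L Δ f - lowNormPart L Δ f
      ≤ ((33 : ℝ) / 25) * etaEff L lam2 * (2 * eps1 L - Tplus L Δ f) * Uunit L Δ f := by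
  have h := RowC.offPoleTail_of_rowCCheckFT L colN11593 ((1 : ℚ) / 2) ((3 : ℚ) / 5) ((449 : ℚ) / 100) ((33 : ℚ) / 25) (50, 24) 1000000
    cellT11593C05000W06000_rowC colN11593_check xsN11593 hL hΔ0 hΔ1 hf
    (by simpa [colN11593] using hν1) (by simpa [colN11593] using hν2) (by push_cast; simpa using ha1) (by push_cast; simpa using ha2)
  simpa using h

end Summit.HubbardSuperconductivity.HubbardSuperconductivity.Theorems.AnisotropyChord.Transfer.Fibre3.L2.KT2b
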